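import Summits.AtomisticToContinuum.BoseEinsteinCondensation.Theorems.BECInfDivCoherenceLevyMassCondensationTranslation
import HarnessLib

/-!
# Crux `GridInfDivCoherence` (stmt-AtomisticToContinuum-9114), line `registered`: stub `stub_cellCoherence_latticeVec`

The cell translation coherence `G_Ψ(i, r) = re ∫_{[0,L)^{3N}} conj Ψ(…, xᵢ + r, …) Ψ(X) dX` of a periodic trial state at
a LATTICE shift `r = L n`, `n ∈ ℤ³`, equals `1`: the wave function is `Lℤ³`-periodic in every particle
(`IsTorusPeriodic.add_single_latticeVec`), so the integrand is `|Ψ|²`, whose cell integral is the normalisation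
(`InfDivGlue.coh_zero`). Used by the lead-c6 necessity theorem `reTranslate_groundState_pos_of_slack` (the case of a
lattice shift, where no Galilei boost can make the coherence negative).
-/

noncomputable section

namespace Summit.AtomisticToContinuum.BoseEinsteinCondensation.Theorems

open MeasureTheory Literature.MathematicalPhysics.QuantumManyBody Literature.MathematicalPhysics.QuantumManyBody.BoseGas
open scoped ENNReal ComplexConjugate

/-- **`stub_cellCoherence_latticeVec`** (registered stub of crux stmt-AtomisticToContinuum-9114, line `registered`,
lead c6). The cell coherence of a periodic trial state at a lattice shift is `1`:
`re ∫_{cell^N} conj Ψ(…, xᵢ + Ln, …) Ψ = 1` (periodicity in particle `i`, then `G(0) = 1`). [folklore] -/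
theorem stub_cellCoherence_latticeVec :
    ∀ (N : ℕ) (L : ℝ) (Ψ : PeriodicTrialState N L) (i : Fin N) (n : Fin 3 → ℤ),
      (∫ X in cellN N L, conj (Ψ.ψ (Function.update X i (X i + latticeVec L n))) * Ψ.ψ X).re = 1 := by
  intro N L Ψ i n
  have hper : ∀ X : Config N, Ψ.ψ (Function.update X i (X i + latticeVec L n)) =
      Ψ.ψ (Function.update X i (X i + 0)) := by
    intro X
    rw [update_eq_add_single, add_zero, Function.update_eq_self]
    exact IsTorusPeriodic.add_single_latticeVec Ψ.periodic X i n
  simp_rw [hper]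
  exact InfDivGlue.coh_zero Ψ i

end Summit.AtomisticToContinuum.BoseEinsteinCondensation.Theorems

end
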